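import Mathlib
import HarnessLib
import Summits.Langlands.Langlands.Statement
import Literature.NumberTheory.Automorphic.AutomorphicTwistBJ
import Literature.NumberTheory.Automorphic.GodementJacquetRankOneEntire
import Literature.NumberTheory.GaloisRepresentations.HeckeCharacterGaloisAvatarProofs

/-!
# Stub `stub_quadraticBaseChangeTwist` (line `descend-raise-basechange`), auxiliary file 2:
# the finite-order twist — class field theory and the Satake / Frobenius bookkeeping

Support file for the crux `EisensteinProModularSeed` (stmt-Langlands-12920), stub S4; everything is
**proved**, no named fact.  Given a continuous character `ν : Γ_K → ℚ̄_pˣ` of finite order, global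
class field theory in the tree (`artinReciprocity_character_holds`, through the rank-one Artin
representation `σ ↦ ι(ν(σ))⁻¹` with open kernel, `FramedGaloisRep.ofOpenKer`) produces a Hecke
character `χ` of finite order, unramified wherever `ν` is trivial on inertia, with
`ν(Φ) = ι⁻¹(χ(ϖ_v))⁻¹` at every arithmetic Frobenius `Φ` above such a place `v`
(`exists_heckeCharacter_of_finiteOrder`; geometric normalisation: `χ(ϖ_v)` is the value of the
*geometric* Frobenius, as in `arithFrobPolyOfSatake ι q 1`).  Then: the Satake parameter of the
twist `Π ⊗ (χ ∘ det)` (`CuspidalAutomorphicRepData.twist`, Borel–Jacquet model) at **every** place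
where `χ` is unramified (`hasSatakeParamAt_twist`, peeling `v` off a level of `χ`), and the
Frobenius characteristic polynomial of a representation `r(σ) = ν(σ) · ρ(σ)` at such a place
(`hasFrobCharpolyAt_of_coe_eq_smul`, `arithFrobPolyOfSatake_map_mul_pair`), which match
(`satakeFrobCompatibleAt_twist`).
-/

set_option linter.dupNamespace false -- project-wide option (lakefile weak.linter.dupNamespace); `Summit.Langlands.Langlands` is the mandated namespace

noncomputable section

open scoped MatrixGroups Matrix NumberField Polynomial Classical
open NumberField IsDedekindDomain Field Polynomial Filter
open Literature.NumberTheory.Automorphic Literature.NumberTheory.GaloisRepresentations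

namespace Summit.Langlands.Langlands.Theorems.SkinnerWilesDefectOne.EisensteinProModularSeed

/-! ## 1. The Hecke character of a finite-order `p`-adic Galois character -/

section CFT

variable {K : Type} [Field K] [NumberField K] {p : ℕ} [Fact p.Prime]

omit [NumberField K] in
/-- A continuous character `ν : Γ_K → ℚ̄_pˣ` of finite order has open kernel: its values lie in
the finite set of `n`-th roots of unity, which is discrete in the Hausdorff space `ℚ̄_p`.
[folklore] -/
theorem isOpen_setOf_eq_one_of_pow_eq_one (ν : absoluteGaloisGroup K →ₜ* (PadicAlgCl p)ˣ)
    {n : ℕ} (hn : 0 < n) (hνn : ∀ σ, ν σ ^ n = 1) :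
    IsOpen {σ : absoluteGaloisGroup K | ν σ = 1} := by
  set T : Set (PadicAlgCl p) := {x | x ^ n = 1} \ {1} with hT
  have hTfin : T.Finite := by
    refine Set.Finite.subset (Polynomial.nthRoots n (1 : PadicAlgCl p)).toFinset.finite_toSet ?_
    intro x hx
    simp only [Finset.mem_coe, Multiset.mem_toFinset, Polynomial.mem_nthRoots hn]
    exact hx.1
  have hopen : IsOpen Tᶜ := hTfin.isClosed.isOpen_compl
  have hcont : Continuous fun σ : absoluteGaloisGroup K => ((ν σ : (PadicAlgCl p)ˣ) : PadicAlgCl p) :=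
    Units.continuous_val.comp ν.continuous
  convert hopen.preimage hcont using 1
  ext σ
  simp only [Set.mem_setOf_eq, Set.mem_preimage, Set.mem_compl_iff, hT, Set.mem_sdiff,
    Set.mem_singleton_iff, not_and, not_not]
  constructor
  · intro h _
    rw [h, Units.val_one]
  · intro h
    exact Units.val_eq_one.mp (h (by rw [← Units.val_pow_eq_pow_val, hνn σ, Units.val_one]))

/-- **The Hecke character of a finite-order `p`-adic Galois character** (global class field
theory, Tate, Cassels–Fröhlich Ch. VII §5.1, in the tree's form `artinReciprocity_character_holds`
applied to the rank-one Artin representation `σ ↦ ι(ν(σ))⁻¹`).  For `ν : Γ_K → ℚ̄_pˣ` continuous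
of finite order there is a Hecke character `χ` of `K` of finite order such that at every finite
place `v` where `ν` kills the inertia groups, `χ` is unramified and
`ν(Φ) = ι⁻¹(χ(ϖ_v))⁻¹` for every arithmetic Frobenius `Φ` above `v` (the geometric Frobenius
corresponds to the uniformiser). [cite: CasselsFrohlichANT1967, Ch. VII §5.1 Main Theorem] -/
theorem exists_heckeCharacter_of_finiteOrder (ι : PadicAlgCl p ≃+* ℂ)
    (ν : absoluteGaloisGroup K →ₜ* (PadicAlgCl p)ˣ) (hν : ∃ n : ℕ, 0 < n ∧ ∀ σ, ν σ ^ n = 1) :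
    ∃ χ : HeckeCharacter K, χ.IsFiniteOrder ∧
      ∀ v : HeightOneSpectrum (𝓞 K),
        (∀ 𝔓 ∈ v.primesAbove, ∀ σ ∈ 𝔓.inertia (absoluteGaloisGroup K), ν σ = 1) →
        χ.IsUnramifiedAt v ∧
          ∀ 𝔓 ∈ v.primesAbove, ∀ Φ : absoluteGaloisGroup K, IsArithFrobAt (𝓞 K) Φ 𝔓 →
            ((ν Φ : (PadicAlgCl p)ˣ) : PadicAlgCl p) = ι.symm (χ.valueAtUniformizer v)⁻¹ := by
  obtain ⟨n, hn, hνn⟩ := hν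
  let θ : absoluteGaloisGroup K →* ℂˣ :=
    ((Units.map ((ι : PadicAlgCl p ≃+* ℂ) : PadicAlgCl p →* ℂ)).comp ν.toMonoidHom)⁻¹
  have hθ : ∀ σ, ((θ σ : ℂˣ) : ℂ) = ι (((ν σ : (PadicAlgCl p)ˣ) : PadicAlgCl p)⁻¹) := fun σ => by
    simp only [θ, MonoidHom.inv_apply, MonoidHom.coe_comp, Function.comp_apply, Units.val_inv_eq_inv_val,
      Units.coe_map, MonoidHom.coe_coe, map_inv₀]
    rfl
  have hθker : ∀ σ, θ σ = 1 ↔ ν σ = 1 := fun σ => by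
    rw [← Units.val_eq_one, hθ, map_eq_one_iff _ ι.injective, inv_eq_one, Units.val_eq_one]
  have hopen : IsOpen (θ.ker : Set (absoluteGaloisGroup K)) := by
    convert isOpen_setOf_eq_one_of_pow_eq_one ν hn hνn using 1
    ext σ
    rw [SetLike.mem_coe, MonoidHom.mem_ker, Set.mem_setOf_eq, hθker]
  set ψ : FramedArtinRep K 1 := FramedGaloisRep.ofOpenKer θ hopen with hψ
  obtain ⟨hfin, hspec⟩ := heckeOfArtinCharacter_spec artinReciprocity_character_holds ψ
  refine ⟨_, hfin, fun v hv => ?_⟩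
  have hψv : ψ.IsUnramifiedAt v :=
    (FramedGaloisRep.isUnramifiedAt_ofOpenKer_iff θ hopen v).mpr
      fun 𝔓 h𝔓 σ hσ => (hθker σ).mpr (hv 𝔓 h𝔓 σ hσ)
  obtain ⟨hχv, hfrob⟩ := hspec v hψv
  refine ⟨hχv, fun 𝔓 h𝔓 Φ hΦ => ?_⟩
  have h1 := (FramedGaloisRep.hasFrobCharpolyAt_ofOpenKer_iff θ hopen v _).mp hfrob 𝔓 h𝔓 Φ hΦ
  rw [hθ] at h1
  have h2 : (((ν Φ : (PadicAlgCl p)ˣ) : PadicAlgCl p))⁻¹ =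
      ι.symm ((heckeOfArtinCharacter artinReciprocity_character_holds ψ).valueAtUniformizer v) := by
    rw [← h1, RingEquiv.symm_apply_apply]
  rw [← inv_inj, h2, map_inv₀, inv_inv]

/-- **Registered auxiliary stub `stub_quadraticBaseChangeTwist_auxCharacter`** (support item of
stub S4 of the line `descend-raise-basechange`): `exists_heckeCharacter_of_finiteOrder`, fully
quantified. [cite: CasselsFrohlichANT1967, Ch. VII §5.1 Main Theorem] -/
theorem stub_quadraticBaseChangeTwist_auxCharacter :
    ∀ (p : ℕ) [Fact p.Prime] (K : Type) [Field K] [NumberField K] (ι : PadicAlgCl p ≃+* ℂ) (ν : Field.absoluteGaloisGroup K →ₜ* (PadicAlgCl p)ˣ), (∃ n : ℕ, 0 < n ∧ ∀ σ, ν σ ^ n = 1) → ∃ χ : Literature.NumberTheory.GaloisRepresentations.HeckeCharacter K, χ.IsFiniteOrder ∧ ∀ v : IsDedekindDomain.HeightOneSpectrum (NumberField.RingOfIntegers K), (∀ 𝔓 ∈ v.primesAbove, ∀ σ ∈ 𝔓.inertia (Field.absoluteGaloisGroup K), ν σ = 1) → χ.IsUnramifiedAt v ∧ ∀ 𝔓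 ∈ v.primesAbove, ∀ Φ : Field.absoluteGaloisGroup K, IsArithFrobAt (NumberField.RingOfIntegers K) Φ 𝔓 → ((ν Φ : (PadicAlgCl p)ˣ) : PadicAlgCl p) = ι.symm (χ.valueAtUniformizer v)⁻¹ :=
  fun _ _ _ _ _ ι ν hν => exists_heckeCharacter_of_finiteOrder ι ν hν

end CFT

/-! ## 2. Satake parameters of the twist at every unramified place of `χ` -/

section Twist

variable {n : ℕ} {K : Type} [Field K] [NumberField K] {hcpt : isCompact_glFiniteIntegralLevel n K}

/-- **`t_{Π ⊗ χ, v} = χ(ϖ_v) t_{Π, v}` at every place `v` where `χ` is unramified** (and `Π` is):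
the tree's `HasSatakeParamAt.twist_of_isUnramifiedAt` at a level of `χ ∘ det` prime to `v`, which
exists by peeling `v` off any level (`HeckeCharacter.exists_level`, `exists_level_peel`).
Arthur–Clozel 1989, Ch. 3, proof of Thm. 3.1 (p. 172).
[cite: ArthurClozelAMS120, Ch. 3, proof of Thm. 3.1 (p. 172)] -/
theorem hasSatakeParamAt_twist (π : AutomorphicRepData (AutomorphyDatum.gl n K hcpt))
    {χ : HeckeCharacter K} (hχ : χ.IsFiniteOrder) {v : HeightOneSpectrum (𝓞 K)} {α : Multiset ℂ}
    (hα : π.HasSatakeParamAt v α) (hv : χ.IsUnramifiedAt v) :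
    (π.twist χ hχ).HasSatakeParamAt v (α.map (χ.valueAtUniformizer v * ·)) := by
  obtain ⟨𝔪, h𝔪, hχ𝔪⟩ := HeckeCharacter.exists_level n χ
  obtain ⟨𝔫, h𝔫, hv𝔫, -, hχ𝔫⟩ := HeckeCharacter.exists_level_peel n χ h𝔪 hχ𝔪 hv
  exact hα.twist_of_isUnramifiedAt hχ h𝔫 hχ𝔫 hv𝔫 hv

end Twist

/-! ## 3. Frobenius characteristic polynomials of `r = ν ⊗ ρ` in rank two -/

section Frob

variable {K : Type} [Field K] [NumberField K] {A : Type*} [Field A] [TopologicalSpace A]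

omit [TopologicalSpace A] in
/-- `2 × 2` matrices: if `charpoly M = (X - x)(X - y)` then `charpoly (a • M) = (X - ax)(X - ay)`
(trace and determinant scale by `a`, `a²`). [folklore] -/
theorem charpoly_smul_of_charpoly_eq_fin_two (M : Matrix (Fin 2) (Fin 2) A) {x y : A}
    (h : M.charpoly = (X - C x) * (X - C y)) (a : A) :
    (a • M).charpoly = (X - C (a * x)) * (X - C (a * y)) := by
  have h' : (X ^ 2 - C M.trace * X + C M.det : A[X]) = X ^ 2 - C (x + y) * X + C (x * y) := by
    rw [← Matrix.charpoly_fin_two, h, map_add, map_mul]; ring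
  have hdet : M.det = x * y := by
    have h0 := congrArg (fun p : A[X] => p.coeff 0) h'
    simpa using h0
  have htr : M.trace = x + y := by
    have h1 := congrArg (fun p : A[X] => p.coeff 1) h'
    have h1' : -M.trace = -y + -x := by simpa using h1
    linear_combination -h1'
  rw [Matrix.charpoly_fin_two, Matrix.trace_smul, Matrix.det_smul, htr, hdet, Fintype.card_fin,
    smul_eq_mul]
  simp only [map_add, map_mul, map_pow]
  ring

omit [NumberField K] in
/-- **Frobenius of a scalar renormalisation.**  If `r(σ) = c(σ) · ρ(σ)` as matrices, `ρ` has
Frobenius characteristic polynomial `(X - x)(X - y)` at `v`, and `c(Φ) = a` for every arithmetic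
Frobenius `Φ` above `v`, then `r` has Frobenius characteristic polynomial `(X - ax)(X - ay)` at
`v`. [folklore] -/
theorem hasFrobCharpolyAt_of_coe_eq_smul (r ρ : FramedGaloisRep K A 2) (c : absoluteGaloisGroup K → A)
    (h : ∀ σ, ((r σ : GL (Fin 2) A) : Matrix (Fin 2) (Fin 2) A) =
      c σ • ((ρ σ : GL (Fin 2) A) : Matrix (Fin 2) (Fin 2) A))
    {v : HeightOneSpectrum (𝓞 K)} {x y : A} (hρ : ρ.HasFrobCharpolyAt v ((X - C x) * (X - C y)))
    {a : A} (hc : ∀ 𝔓 ∈ v.primesAbove, ∀ Φ : absoluteGaloisGroup K, IsArithFrobAt (𝓞 K) Φ 𝔓 → c Φ = a) :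
    r.HasFrobCharpolyAt v ((X - C (a * x)) * (X - C (a * y))) := by
  intro 𝔓 h𝔓 Φ hΦ
  have hch : ((ρ Φ : GL (Fin 2) A) : Matrix (Fin 2) (Fin 2) A).charpoly = (X - C x) * (X - C y) :=
    hρ 𝔓 h𝔓 Φ hΦ
  rw [FramedRep.charpoly, h Φ, hc 𝔓 h𝔓 Φ hΦ]
  exact charpoly_smul_of_charpoly_eq_fin_two _ hch a

variable {p : ℕ} [Fact p.Prime]

/-- `arithFrobPolyOfSatake ι q 1 {b₁, b₂} = (X - ι⁻¹(b₁⁻¹))(X - ι⁻¹(b₂⁻¹))`. [folklore] -/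
theorem arithFrobPolyOfSatake_one_pair (ι : PadicAlgCl p ≃+* ℂ) (q : ℕ) (b₁ b₂ : ℂ) :
    arithFrobPolyOfSatake ι q 1 ({b₁, b₂} : Multiset ℂ) =
      (X - C (ι.symm b₁⁻¹)) * (X - C (ι.symm b₂⁻¹)) := by
  rw [arithFrobPolyOfSatake_one]
  simp only [Multiset.insert_eq_cons, Multiset.map_cons, Multiset.map_singleton, Multiset.prod_cons,
    Multiset.prod_singleton]

/-- **Scaling a Satake pair scales the predicted Frobenius roots**:
`arithFrobPolyOfSatake ι q 1 {z b₁, z b₂} = (X - a x)(X - a y)` with `a = ι⁻¹(z⁻¹)`,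
`x = ι⁻¹(b₁⁻¹)`, `y = ι⁻¹(b₂⁻¹)`. [folklore] -/
theorem arithFrobPolyOfSatake_map_mul_pair (ι : PadicAlgCl p ≃+* ℂ) (q : ℕ) (z b₁ b₂ : ℂ) :
    arithFrobPolyOfSatake ι q 1 (({b₁, b₂} : Multiset ℂ).map (z * ·)) =
      (X - C (ι.symm z⁻¹ * ι.symm b₁⁻¹)) * (X - C (ι.symm z⁻¹ * ι.symm b₂⁻¹)) := by
  have hm : (({b₁, b₂} : Multiset ℂ).map (z * ·)) = {z * b₁, z * b₂} := by
    simp only [Multiset.insert_eq_cons, Multiset.map_cons, Multiset.map_singleton]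
  rw [hm, arithFrobPolyOfSatake_one_pair, mul_inv, mul_inv, map_mul ι.symm, map_mul ι.symm]

end Frob

/-! ## 4. Satake–Frobenius compatibility of the twist -/

section Assembly

variable {K : Type} [Field K] [NumberField K] {p : ℕ} [Fact p.Prime]
  {hcpt : isCompact_glFiniteIntegralLevel 2 K}

/-- **Twisting both sides.**  Let `Π` be an automorphic representation of `GL₂(𝔸_K)`,
`ρ : Γ_K → GL₂(ℚ̄_p)`, and suppose `SatakeFrobCompatibleAt ι Π ρ v`.  Let `χ` be a finite-order
Hecke character unramified at `v` and `ν : Γ_K → ℚ̄_pˣ` with `ν(Φ) = ι⁻¹(χ(ϖ_v))⁻¹` at the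
arithmetic Frobenii above `v`; let `r(σ) = ν(σ) · ρ(σ)` be unramified at `v`.  Then
`SatakeFrobCompatibleAt ι (Π ⊗ χ) r v`. [folklore] -/
theorem satakeFrobCompatibleAt_twist (ι : PadicAlgCl p ≃+* ℂ)
    (π : AutomorphicRepData (AutomorphyDatum.gl 2 K hcpt)) (ρ r : FramedGaloisRep K (PadicAlgCl p) 2)
    {χ : HeckeCharacter K} (hχ : χ.IsFiniteOrder) (ν : absoluteGaloisGroup K → PadicAlgCl p)
    (h : ∀ σ, ((r σ : GL (Fin 2) (PadicAlgCl p)) : Matrix (Fin 2) (Fin 2) (PadicAlgCl p)) =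
      ν σ • ((ρ σ : GL (Fin 2) (PadicAlgCl p)) : Matrix (Fin 2) (Fin 2) (PadicAlgCl p)))
    {v : HeightOneSpectrum (𝓞 K)} (hv : χ.IsUnramifiedAt v)
    (hν : ∀ 𝔓 ∈ v.primesAbove, ∀ Φ : absoluteGaloisGroup K, IsArithFrobAt (𝓞 K) Φ 𝔓 →
      ν Φ = ι.symm (χ.valueAtUniformizer v)⁻¹)
    (hr : r.IsUnramifiedAt v) (hc : Summit.Langlands.SatakeFrobCompatibleAt ι π ρ v) :
    Summit.Langlands.SatakeFrobCompatibleAt ι (π.twist χ hχ) r v := by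
  obtain ⟨β, hβ, -, hP⟩ := hc
  refine ⟨β.map (χ.valueAtUniformizer v * ·), hasSatakeParamAt_twist π hχ hβ hv, hr, ?_⟩
  obtain ⟨b₁, b₂, rfl⟩ := Multiset.card_eq_two.mp hβ.card_eq
  rw [arithFrobPolyOfSatake_map_mul_pair]
  rw [arithFrobPolyOfSatake_one_pair] at hP
  exact hasFrobCharpolyAt_of_coe_eq_smul r ρ ν h hP hν

end Assembly

end Summit.Langlands.Langlands.Theorems.SkinnerWilesDefectOne.EisensteinProModularSeed

end
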